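import Summits.Ventures.HSemireg.WedgeWeilDegKernel

/-!
# Venture HSemireg — THEOREM R-B in the wedge model (7/9)

HONEST FRAMING. Part of the Lean index of the computation cell `pub-hsemireg` (seat p3; Sunday enclosure of the
FORMULA-N kernel assets of seats th-7 / th-6, ENCLOSURE-PLAN-p3.md).  Finite-dimensional exterior algebra over a field ONLY:
no variety, no cohomology theory, no semiregularity map is constructed here; nothing here says that HC / HC_CM / HC_AV holds;
no Literature fact is declared or used.  The geometric DICTIONARY (why these ranks are the `HT`-side box ranks of the cell's
STRUCTURE.md §1 / theory/FORMULA-N.md) lives in theory/FORMULA-N-th7.md PART B §A.3 / §N and is NOT asserted in Lean.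

THEOREM R-B (FORMULA-N PART B §L.3 / §L.8; STRUCTURE D9, (F1) Weil-frame clause, C16) in the SIGN-FREE transposed wedge model — theory/th7/WeilRank.lean v3 sha256/16 7e5d6bad1a94e25a (th-7 g4, 18:46Z; ×2 farm th-2 g20 18:48:20Z); PART R/R2/R3 = l.1506–3436 on top of HankelRank v1 (= the tree's Wedge/WedgeHankel* files), VERBATIM up
to namespaces (`HSemiregWeil` ↦ `Summit.Ventures.HSemireg.Wedge.Weil`, which sees the wedge-model infrastructure `….Wedge` and opens `….Wedge.Hankel`), file 7 of 9.
MODEL: `N` pairs of generators `x_c`, `y_c`; the h-part `f = w_N(q)` (HankelRank); the «Weil vectors» `w₊ = E_{G₋}`, `w₋ = E_{G₊}` = the full monomials on the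
generator blocks of the last `N − p` / first `p` pairs (signature `(p, N − p)`; THEOREM R is `N = 2n`, `p = n`).  HEADLINES (files 5, 8, 9): `weilRank` /
`weilRank_nn` («rank(⌟v ∣ HT²) = (4 + ρ)·n² − 2n», `v = f + a w₊ + b w₋`, `ab ≠ 0`, `n ≥ 3`, ρ = rank H₂(q)), `ker_eq` (kernel = mixed 2-forms killing `f`),
`weilRank_deg` / `weilRank_nn_deg` (every degree `m`, `m + 1 ≤ N − p`), `weilRank_one` / `weilRank_nn_one` (one-sided, ε = 1).  No permutation sign is evaluated
(the pair symmetries act through `AlternatingMap.map_perm`; `sgn κ` is a unit).  This file (PART R2, 2/3): selections `Sel S t`, the selection pieces `Sp (Sel S)` of `Λ^m ∧ f`, their permutation symmetry and **`finrank_map_f_Sel`** (each has rank ρ_m).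
-/

open Module Set Set.powersetCard Summit.Ventures.HSemireg.Wedge.Hankel

namespace Summit.Ventures.HSemireg.Wedge.Weil

variable (K : Type*) [Field K]

section AllDegrees

variable {N : ℕ}

/-- a selection is injective on pair indices. -/
lemma Sel.injOn {S : Finset (Fin N)} {t : Finset (In N)} (h : Sel N S t) : Set.InjOn pr (t : Set (In N)) := by
  classical
  apply Finset.card_image_iff.mp
  rw [h.2, ← h.1]

omit [Field K] in
/-- a selection contains no partner pair. -/
lemma Sel.pt_notMem {S : Finset (Fin N)} {t : Finset (In N)} (h : Sel N S t) {i : In N} (hi : i ∈ t) :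
    pt i ∉ t := fun hpi =>
  pt_ne_self i (h.injOn (Finset.mem_coe.mpr hpi) (Finset.mem_coe.mpr hi) (pr_pt i))

omit [Field K] in
/-- a selection meets every selected pair. -/
lemma Sel.exists_mem {S : Finset (Fin N)} {t : Finset (In N)} (h : Sel N S t) {c : Fin N} (hc : c ∈ S) :
    ∃ i ∈ t, pr i = c := by
  classical
  rw [← h.2, Finset.mem_image] at hc
  exact hc

/-- `(Sp (Sel S)) ∧ f ⊆ Sp (Qpred S)`. -/
lemma map_f_Sel_le (S : Finset (Fin N)) (q : ℕ → K) :
    (Sp K (Sel N S)).map (LinearMap.mulRight K (w K N N q)) ≤ Sp K (Qpred (N := N) S) := by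
  classical
  rw [Submodule.map_le_iff_le_comap, Sp]
  apply Submodule.span_le.mpr
  rintro _ ⟨t, ht, rfl⟩
  rw [SetLike.mem_coe, Submodule.mem_comap, LinearMap.mulRight_apply]
  refine mul_mem_Sp (P := fun t' => t' = t) (Q := Fsupp (N := N) 0) (R := Qpred (N := N) S) ?_ (B_mem_Sp rfl)
    (f_mem_Sp K 0 q)
  intro s₁ t' hd hs₁ ht'
  rw [hs₁] at hd ⊢
  have htr := ht'.1
  intro i
  simp only [Finset.mem_union]
  constructor
  · rintro ⟨h1, h2⟩
    by_contra hc
    have a1 : i ∉ t := fun h => hc (ht.2 ▸ Finset.mem_image_of_mem pr h)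
    have a2 : pt i ∉ t := fun h => hc (by rw [← pr_pt i, ← ht.2]; exact Finset.mem_image_of_mem pr h)
    have b1 : i ∈ t' := h1.resolve_left a1
    have b2 : pt i ∈ t' := h2.resolve_left a2
    exact ((htr i).mp b1) b2
  · intro hc
    obtain ⟨i₀, hi₀, he⟩ := ht.exists_mem hc
    have hpt : pt i₀ ∉ t := ht.pt_notMem hi₀
    have hi₀' : i₀ ∉ t' := fun h => Finset.disjoint_left.mp hd hi₀ h
    have hpt' : pt i₀ ∈ t' := by by_contra h; exact hi₀' ((htr i₀).mpr h)
    rcases eq_or_eq_pt_of_pr_eq he.symm with e | e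
    · -- i₀ = i
      subst e
      exact ⟨Or.inl hi₀, Or.inr hpt'⟩
    · -- i₀ = pt i
      subst e
      refine ⟨Or.inr (by rw [pt_pt] at hpt'; exact hpt'), Or.inl hi₀⟩

/-- `Sp (Sel S) ≤ Λ^m` for `|S| = m`. -/
lemma Sp_Sel_le_Hom {m : ℕ} {S : Finset (Fin N)} (hS : S.card = m) : Sp K (Sel N S) ≤ Hom K (In N) Finset.univ m :=
  Sp_mono fun t ht => ⟨Finset.subset_univ t, ht.1.trans hS⟩

/-! #### algebra automorphisms permuting the generators act on monomials by units -/

/-- an algebra automorphism permuting generators carries a monomial to a unit multiple of a monomial. -/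
lemma algEquiv_B (φ : HT K (In N) ≃ₐ[K] HT K (In N)) (π : Equiv.Perm (In N))
    (hφ : ∀ i, φ (gx K i) = gx K (π i)) (t : Finset (In N)) :
    ∃ c : K, c ≠ 0 ∧ φ (B K (In N) t) = c • B K (In N) (t.map π.toEmbedding) := by
  classical
  induction t using Finset.induction_on with
  | empty => exact ⟨1, one_ne_zero, by rw [Finset.map_empty, B_empty, map_one, one_smul]⟩
  | insert i s hi ih =>
    obtain ⟨c, hc, hcs⟩ := ih
    have hu : u K ({i} : Finset (In N)) s ≠ 0 := (u_ne_zero_iff K).mpr (Finset.disjoint_singleton_left.mpr hi)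
    have hB : B K (In N) (insert i s) = (u K {i} s)⁻¹ • (gx K i * B K (In N) s) := by
      rw [gx, B_mul_B, smul_smul, inv_mul_cancel₀ hu, one_smul, Finset.insert_eq]
    have hi' : π i ∉ s.map π.toEmbedding := by
      rw [Finset.mem_map_equiv, Equiv.symm_apply_apply]; exact hi
    have hu' : u K ({π i} : Finset (In N)) (s.map π.toEmbedding) ≠ 0 :=
      (u_ne_zero_iff K).mpr (Finset.disjoint_singleton_left.mpr hi')
    refine ⟨(u K {i} s)⁻¹ * c * u K {π i} (s.map π.toEmbedding), mul_ne_zero (mul_ne_zero (inv_ne_zero hu) hc) hu', ?_⟩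
    rw [hB, map_smul, map_mul, hφ, hcs, mul_smul_comm, gx, B_mul_B, smul_smul, smul_smul, Finset.map_insert,
      Finset.insert_eq]
    rfl

/-- such an automorphism carries `Sp P` into `Sp P'` for compatible predicates. -/
lemma map_algEquiv_Sp_le (φ : HT K (In N) ≃ₐ[K] HT K (In N)) (π : Equiv.Perm (In N))
    (hφ : ∀ i, φ (gx K i) = gx K (π i)) {P P' : Finset (In N) → Prop}
    (hPP' : ∀ t, P t → P' (t.map π.toEmbedding)) : (Sp K P).map φ.toLinearMap ≤ Sp K P' := by
  rw [Submodule.map_le_iff_le_comap, Sp]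
  apply Submodule.span_le.mpr
  rintro _ ⟨t, ht, rfl⟩
  obtain ⟨c, _, hc⟩ := algEquiv_B K φ π hφ t
  rw [SetLike.mem_coe, Submodule.mem_comap, AlgEquiv.toLinearMap_apply, hc]
  exact Submodule.smul_mem _ _ (B_mem_Sp (hPP' t ht))

omit [Field K] in
/-- `(dup κ)⁻¹ = dup κ⁻¹`. -/
lemma dup_symm (κ : Equiv.Perm (Fin N)) : (dup N κ).symm = dup N κ⁻¹ := by
  have h : dup N κ * dup N κ⁻¹ = 1 := by rw [← dup_mul, mul_inv_cancel, dup_one]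
  exact (Equiv.Perm.inv_def _).symm.trans (inv_eq_of_mul_eq_one_right h)

/-- `σκ⁻¹` on generator monomials. -/
lemma σκ_symm_gx (κ : Equiv.Perm (Fin N)) (i : In N) :
    (σκ K N κ).symm (gx K i) = gx K ((dup N κ).symm i) := by
  have h := σκ_gx K κ ((dup N κ).symm i)
  rw [Equiv.apply_symm_apply] at h
  rw [← h, AlgEquiv.symm_apply_apply]

omit [Field K] in
/-- selections are permuted by pair permutations. -/
lemma Sel_map (κ : Equiv.Perm (Fin N)) {S : Finset (Fin N)} {t : Finset (In N)} (h : Sel N S t) :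
    Sel N (S.map κ.toEmbedding) (t.map (dup N κ).toEmbedding) := by
  classical
  refine ⟨by rw [Finset.card_map, Finset.card_map, h.1], ?_⟩
  rw [Finset.map_eq_image, Finset.map_eq_image, Finset.image_image, ← h.2, Finset.image_image]
  congr 1
  funext i
  simp only [Function.comp_apply, Equiv.toEmbedding_apply, pr_dup]

/-- **symmetry transport of the selection pieces.** -/
lemma map_σκ_Sp_Sel (κ : Equiv.Perm (Fin N)) (S : Finset (Fin N)) :
    (Sp K (Sel N S)).map (σκ K N κ).toLinearMap = Sp K (Sel N (S.map κ.toEmbedding)) := by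
  classical
  apply le_antisymm
  · exact map_algEquiv_Sp_le K (σκ K N κ) (dup N κ) (σκ_gx K κ) fun t ht => Sel_map κ ht
  · intro y hy
    have h1 : (σκ K N κ).symm y ∈ Sp K (Sel N S) := by
      have h2 := map_algEquiv_Sp_le K (σκ K N κ).symm (dup N κ).symm (σκ_symm_gx K κ)
        (P := Sel N (S.map κ.toEmbedding)) (P' := Sel N S) (fun t ht => by
          have h3 := Sel_map κ⁻¹ ht
          have e : (S.map κ.toEmbedding).map κ⁻¹.toEmbedding = S := by
            rw [Finset.map_map]
            convert Finset.map_refl (s := S) using 2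
            ext c
            simp
          rw [e] at h3
          rw [dup_symm]
          exact h3)
      exact h2 (Submodule.mem_map_of_mem hy)
    have : y = (σκ K N κ).toLinearMap ((σκ K N κ).symm y) := by
      rw [AlgEquiv.toLinearMap_apply, AlgEquiv.apply_symm_apply]
    rw [this]
    exact Submodule.mem_map_of_mem h1

/-- transitivity of `S_N` on `m`-subsets. -/
lemma exists_perm_map_eq_card {S S' : Finset (Fin N)} (h : S.card = S'.card) :
    ∃ κ : Equiv.Perm (Fin N), S.map κ.toEmbedding = S' := by
  classical
  have e : {c // c ∈ S} ≃ {c // c ∈ S'} :=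
    Fintype.equivOfCardEq (by rw [Fintype.card_coe, Fintype.card_coe, h])
  refine ⟨e.extendSubtype, ?_⟩
  apply Finset.eq_of_subset_of_card_le
  · intro x hx
    rw [Finset.mem_map] at hx
    obtain ⟨c, hc, rfl⟩ := hx
    rw [Equiv.toEmbedding_apply, Equiv.extendSubtype_apply_of_mem e c hc]
    exact (e ⟨c, hc⟩).2
  · rw [Finset.card_map, h]

/-- selection pieces of equal size have equal `∧ f`-rank. -/
lemma finrank_map_f_Sel_eq {S S' : Finset (Fin N)} (h : S.card = S'.card) (q : ℕ → K) :
    Module.finrank K ↥((Sp K (Sel N S)).map (LinearMap.mulRight K (w K N N q))) =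
      Module.finrank K ↥((Sp K (Sel N S')).map (LinearMap.mulRight K (w K N N q))) := by
  obtain ⟨κ, hκ⟩ := exists_perm_map_eq_card (N := N) h
  rw [← hκ, ← map_σκ_Sp_Sel, finrank_map_f_map_σκ]

/-- a monomial containing a full pair is killed by `f`. -/
lemma B_mul_f_eq_zero_of_pair {t : Finset (In N)} {i : In N} (hi : i ∈ t) (hpi : pt i ∈ t) (q : ℕ → K) :
    B K (In N) t * w K N N q = 0 := by
  refine B_mul_eq_zero_of_mem_Sp (P := Fsupp (N := N) 0) (fun t' ht' hd => ?_) (f_mem_Sp K 0 q)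
  by_cases h : i ∈ t'
  · exact Finset.disjoint_left.mp hd hi h
  · exact Finset.disjoint_left.mp hd hpi (by by_contra h'; exact h ((ht'.1 i).mpr h'))

/-- the alternative for a monomial: a selection, or it contains a full pair. -/
lemma sel_or_pair (t : Finset (In N)) :
    Sel N (t.image pr) t ∨ ∃ i ∈ t, pt i ∈ t := by
  classical
  by_cases hc : (t.image pr).card = t.card
  · exact Or.inl ⟨hc.symm, rfl⟩
  · right
    have hni : ¬ Set.InjOn pr (t : Set (In N)) := fun h => hc (Finset.card_image_iff.mpr h)
    simp only [Set.InjOn, not_forall, exists_prop, Finset.mem_coe] at hni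
    obtain ⟨i, hi, j, hj, hpr, hne⟩ := hni
    have : j = pt i := (eq_or_eq_pt_of_pr_eq hpr).resolve_left (Ne.symm hne)
    exact ⟨i, hi, this ▸ hj⟩

/-- **total decomposition in degree m.** -/
lemma map_f_Hom_eq_deg (m : ℕ) (q : ℕ → K) :
    (Hom K (In N) Finset.univ m).map (LinearMap.mulRight K (w K N N q)) =
      ⨆ S ∈ (Finset.univ : Finset (Fin N)).powersetCard m,
        (Sp K (Sel N S)).map (LinearMap.mulRight K (w K N N q)) := by
  classical
  apply le_antisymm
  · rw [Submodule.map_le_iff_le_comap, Hom]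
    apply Submodule.span_le.mpr
    rintro _ ⟨t, ⟨-, ht⟩, rfl⟩
    rw [SetLike.mem_coe, Submodule.mem_comap, LinearMap.mulRight_apply]
    dsimp only
    rcases sel_or_pair (N := N) t with hsel | ⟨i, hi, hpi⟩
    · have hS : t.image pr ∈ (Finset.univ : Finset (Fin N)).powersetCard m := by
        rw [Finset.mem_powersetCard_univ, ← hsel.1, ht]
      have hmem : B K (In N) t * w K N N q ∈ (Sp K (Sel N (t.image pr))).map (LinearMap.mulRight K (w K N N q)) :=
        Submodule.mem_map_of_mem (B_mem_Sp hsel)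
      exact le_biSup (fun S => (Sp K (Sel N S)).map (LinearMap.mulRight K (w K N N q))) hS hmem
    · rw [B_mul_f_eq_zero_of_pair K hi hpi]; exact Submodule.zero_mem _
  · exact iSup₂_le fun S hS => Submodule.map_mono (Sp_Sel_le_Hom K (Finset.mem_powersetCard_univ.mp hS))

/-- **every selection piece has rank ρ_m = rank H_m(q)** (for `|S| = m ≤ N`). -/
theorem finrank_map_f_Sel {m : ℕ} {S₀ : Finset (Fin N)} (hS₀ : S₀.card = m) (q : ℕ → K) :
    Module.finrank K ↥((Sp K (Sel N S₀)).map (LinearMap.mulRight K (w K N N q))) = (hankel1 K N m q).rank := by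
  classical
  have htot : Module.finrank K ↥((Hom K (In N) Finset.univ m).map (LinearMap.mulRight K (w K N N q))) =
      N.choose m * (hankel1 K N m q).rank := by
    rw [← range_wedge]; exact hankelLaw_model K m q
  rw [map_f_Hom_eq_deg,
    finrank_biSup_eq_sum _ _ (fun S => Qpred N S)
      (fun S _ => map_f_Sel_le K S q)
      (fun S _ S' _ hSS' => Qpred_disjoint hSS'),
    Finset.sum_const_nat (m := Module.finrank K ↥((Sp K (Sel N S₀)).map (LinearMap.mulRight K (w K N N q))))
      (fun S hS => finrank_map_f_Sel_eq K ((Finset.mem_powersetCard_univ.mp hS).trans hS₀.symm) q),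
    Finset.card_powersetCard, Finset.card_univ, Fintype.card_fin] at htot
  have hpos : 0 < N.choose m := by
    rw [← Fintype.card_fin N, ← Finset.card_univ, ← Finset.card_powersetCard]
    exact Finset.card_pos.mpr ⟨S₀, Finset.mem_powersetCard_univ.mpr hS₀⟩
  exact Nat.eq_of_mul_eq_mul_left hpos htot

/-! #### the mixed pieces and the counts -/

end AllDegrees

end Summit.Ventures.HSemireg.Wedge.Weil
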